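import Mathlib
import Summits.PneNP.PneNP.Theorems.OverlapGapAlgebraSearchHardWindowSequentialLocalPostProc
import Summits.PneNP.PneNP.Theorems.OverlapGapAlgebraSearchHardWindowLipschitzRungDegree

/-!
# PneNP / OverlapGapAlgebra — `SearchHardWindow` / `SolvableImpliesStableSection`:
# sequential local decimation followed by LOCAL POST-PROCESSING (2/3) — the mean-square bound

Support for cruxes `stmt-PneNP-2460` and `stmt-PneNP-2463`. For an index-order decimation rule with
unit look-ahead `g₀` (hypothesis `hseq`) and a radius-`r` local function `g` of `(Φ, g₀ Φ)`
(hypothesis `hpost`), the mean-square single-literal sensitivity of `g` is polylogarithmic: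

* `shwSeqP_sum_cone_lit`, `shwSeqP_sum_cone_old` — the two cone sums of `…SequentialLocalSens`,
  isolated: `∑_Φ ∑_ℓ T(Φ, ℓ.1)² ≤ 2n K N` and `∑_Φ T_{∖a}(Φ, (Φ a q).1)² ≤ K N`,
  `K = (1+β)e^{β(1+k²+β)}`, `β = mk²/n`;
* `shwSeqP_meanSquare` — for `1 ≤ n`, `m ≤ αn`, `e^{αke²} ≤ n³`:
  `∑_{(a,b)} ∑_{(Φ,ℓ)} d_H(g Φ, g Φ[(a,b) ↦ ℓ])² ≤ (8k²P + 2(k+1)²PK + 1)·(mk)·#Inst·2n` with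
  `P = (3k log n + k + 1)^{2r}`, `K = (1+αk²)e^{αk²(1+k²+αk²)}` — typical instances (maximum
  clause-degree `≤ 3 log n`) through the light cones of file 1/3 and the bounded second moment of
  increasing cones, the exceptional ones through `n²·#{D > 3 log n} ≤ #Inst`.
No definitions; axioms `propext`, `Classical.choice`, `Quot.sound`.
-/

set_option linter.dupNamespace false -- `Summit.PneNP.PneNP.…`: summit = sub-problem (D-0017)

namespace Summit.PneNP.PneNP.Theorems

open Finset
open scoped Classical

section SeqPostMS

variable {m k n : ℕ}

/-- The cone sum over the new literal: `∑_Φ ∑_ℓ T(Φ, ℓ.1)² ≤ 2n · K · N`. -/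
theorem shwSeqP_sum_cone_lit (hn : 1 ≤ n) :
    ∑ Φ : (Fin m → Fin k → Fin n × Bool), ∑ ℓ : Fin n × Bool,
        ((((Finset.univ : Finset (Fin n)).filter fun ww => (∃ (ll : ℕ) (xx : ℕ → Fin n), xx 0 = ℓ.1 ∧ xx ll = ww ∧ ∀ ss : ℕ, ss < ll →
          (xx ss < xx (ss + 1) ∧ ∃ cc ∈ (Finset.univ : Finset (Fin m)), ∃ pp qq : Fin k,
            (Φ cc pp).1 = xx ss ∧ (Φ cc qq).1 = xx (ss + 1)))).card : ℕ) : ℝ) ^ 2 ≤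
      2 * n * (((1 + (m : ℝ) * (k : ℝ) ^ 2 / n) *
        Real.exp (((m : ℝ) * (k : ℝ) ^ 2 / n) * (1 + (k : ℝ) ^ 2 + (m : ℝ) * (k : ℝ) ^ 2 / n))) *
          (Fintype.card (Fin m → Fin k → Fin n × Bool) : ℝ)) := by
  rw [Finset.sum_comm]
  calc ∑ ℓ : Fin n × Bool, ∑ Φ : (Fin m → Fin k → Fin n × Bool), ((((Finset.univ : Finset (Fin n)).filter fun ww => (∃ (ll : ℕ) (xx : ℕ → Fin n), xx 0 = ℓ.1 ∧ xx ll = ww ∧ ∀ ss : ℕ, ss < ll →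
          (xx ss < xx (ss + 1) ∧ ∃ cc ∈ (Finset.univ : Finset (Fin m)), ∃ pp qq : Fin k,
            (Φ cc pp).1 = xx ss ∧ (Φ cc qq).1 = xx (ss + 1)))).card : ℕ) : ℝ) ^ 2
      ≤ ∑ _ℓ : Fin n × Bool, (((1 + (m : ℝ) * (k : ℝ) ^ 2 / n) *
        Real.exp (((m : ℝ) * (k : ℝ) ^ 2 / n) * (1 + (k : ℝ) ^ 2 + (m : ℝ) * (k : ℝ) ^ 2 / n))) *
          (Fintype.card (Fin m → Fin k → Fin n × Bool) : ℝ)) := Finset.sum_le_sum fun ℓ _ => shwSeq_S2_le hn ℓ.1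
    _ = _ := by
        rw [Finset.sum_const, Finset.card_univ, nsmul_eq_mul, Fintype.card_prod, Fintype.card_fin,
          Fintype.card_bool]
        push_cast; ring

/-- The cone sum over an old variable of clause `a`: `∑_Φ T_{∖a}(Φ, (Φ a q).1)² ≤ K · N`. -/
theorem shwSeqP_sum_cone_old (hn : 1 ≤ n) (a : Fin m) (q : Fin k) :
    ∑ Φ : (Fin m → Fin k → Fin n × Bool), ((((Finset.univ : Finset (Fin n)).filter fun ww => (∃ (ll : ℕ) (xx : ℕ → Fin n), xx 0 = ((Φ a q).1) ∧ xx ll = ww ∧ ∀ ss : ℕ, ss < ll →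
          (xx ss < xx (ss + 1) ∧ ∃ cc ∈ ((Finset.univ : Finset (Fin m)).erase a), ∃ pp qq : Fin k,
            (Φ cc pp).1 = xx ss ∧ (Φ cc qq).1 = xx (ss + 1)))).card : ℕ) : ℝ) ^ 2 ≤
      ((1 + (m : ℝ) * (k : ℝ) ^ 2 / n) *
        Real.exp (((m : ℝ) * (k : ℝ) ^ 2 / n) * (1 + (k : ℝ) ^ 2 + (m : ℝ) * (k : ℝ) ^ 2 / n))) *
          (Fintype.card (Fin m → Fin k → Fin n × Bool) : ℝ) := by
  have hnpos : (0 : ℝ) < n := by exact_mod_cast hn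
  set K₀ : ℝ := (1 + (m : ℝ) * (k : ℝ) ^ 2 / n) *
      Real.exp (((m : ℝ) * (k : ℝ) ^ 2 / n) * (1 + (k : ℝ) ^ 2 + (m : ℝ) * (k : ℝ) ^ 2 / n)) with hK₀
  set N : ℝ := (Fintype.card (Fin m → Fin k → Fin n × Bool) : ℝ) with hN
  have hins : ∀ Φ : (Fin m → Fin k → Fin n × Bool), ((((Finset.univ : Finset (Fin n)).filter fun ww => (∃ (ll : ℕ) (xx : ℕ → Fin n), xx 0 = ((Φ a q).1) ∧ xx ll = ww ∧ ∀ ss : ℕ, ss < ll →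
          (xx ss < xx (ss + 1) ∧ ∃ cc ∈ ((Finset.univ : Finset (Fin m)).erase a), ∃ pp qq : Fin k,
            (Φ cc pp).1 = xx ss ∧ (Φ cc qq).1 = xx (ss + 1)))).card : ℕ) : ℝ) ^ 2 =
      ∑ w : Fin n, (if (Φ a q).1 = w then
        ((((Finset.univ : Finset (Fin n)).filter fun ww => (∃ (ll : ℕ) (xx : ℕ → Fin n), xx 0 = w ∧ xx ll = ww ∧ ∀ ss : ℕ, ss < ll →
          (xx ss < xx (ss + 1) ∧ ∃ cc ∈ ((Finset.univ : Finset (Fin m)).erase a), ∃ pp qq : Fin k,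
            (Φ cc pp).1 = xx ss ∧ (Φ cc qq).1 = xx (ss + 1)))).card : ℕ) : ℝ) ^ 2 else 0) := by
    intro Φ
    rw [Finset.sum_ite_eq]
    simp only [Finset.mem_univ, if_true]
  rw [Finset.sum_congr rfl fun Φ _ => hins Φ, Finset.sum_comm]
  have hw : ∀ w : Fin n, ∑ Φ : (Fin m → Fin k → Fin n × Bool), (if (Φ a q).1 = w then
      ((((Finset.univ : Finset (Fin n)).filter fun ww => (∃ (ll : ℕ) (xx : ℕ → Fin n), xx 0 = w ∧ xx ll = ww ∧ ∀ ss : ℕ, ss < ll →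
          (xx ss < xx (ss + 1) ∧ ∃ cc ∈ ((Finset.univ : Finset (Fin m)).erase a), ∃ pp qq : Fin k,
            (Φ cc pp).1 = xx ss ∧ (Φ cc qq).1 = xx (ss + 1)))).card : ℕ) : ℝ) ^ 2 else 0) =
      (1 / n) * ∑ Φ : (Fin m → Fin k → Fin n × Bool), ((((Finset.univ : Finset (Fin n)).filter fun ww => (∃ (ll : ℕ) (xx : ℕ → Fin n), xx 0 = w ∧ xx ll = ww ∧ ∀ ss : ℕ, ss < ll →
          (xx ss < xx (ss + 1) ∧ ∃ cc ∈ ((Finset.univ : Finset (Fin m)).erase a), ∃ pp qq : Fin k,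
            (Φ cc pp).1 = xx ss ∧ (Φ cc qq).1 = xx (ss + 1)))).card : ℕ) : ℝ) ^ 2 := by
    intro w
    have h := shwSeq_sum_slot_indicator a q w
      (fun Φ => ((((Finset.univ : Finset (Fin n)).filter fun ww => (∃ (ll : ℕ) (xx : ℕ → Fin n), xx 0 = w ∧ xx ll = ww ∧ ∀ ss : ℕ, ss < ll →
          (xx ss < xx (ss + 1) ∧ ∃ cc ∈ ((Finset.univ : Finset (Fin m)).erase a), ∃ pp qq : Fin k,
            (Φ cc pp).1 = xx ss ∧ (Φ cc qq).1 = xx (ss + 1)))).card : ℕ) : ℝ) ^ 2)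
      (fun Φ ℓ' => by simp only [shwSeq_T_erase_update])
    rw [← Finset.sum_filter, one_div, inv_mul_eq_div, eq_div_iff hnpos.ne', mul_comm]
    exact h
  rw [Finset.sum_congr rfl fun w _ => hw w, ← Finset.mul_sum]
  have hS2 : ∀ w : Fin n, (∑ Φ : (Fin m → Fin k → Fin n × Bool), ((((Finset.univ : Finset (Fin n)).filter fun ww => (∃ (ll : ℕ) (xx : ℕ → Fin n), xx 0 = w ∧ xx ll = ww ∧ ∀ ss : ℕ, ss < ll →
          (xx ss < xx (ss + 1) ∧ ∃ cc ∈ (Finset.univ : Finset (Fin m)), ∃ pp qq : Fin k,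
            (Φ cc pp).1 = xx ss ∧ (Φ cc qq).1 = xx (ss + 1)))).card : ℕ) : ℝ) ^ 2) ≤ K₀ * N := fun w => by
    have := shwSeq_S2_le (m := m) (k := k) hn w
    rw [hK₀, hN]; exact this
  have hmono : ∑ w : Fin n, ∑ Φ : (Fin m → Fin k → Fin n × Bool),
      ((((Finset.univ : Finset (Fin n)).filter fun ww => (∃ (ll : ℕ) (xx : ℕ → Fin n), xx 0 = w ∧ xx ll = ww ∧ ∀ ss : ℕ, ss < ll →
          (xx ss < xx (ss + 1) ∧ ∃ cc ∈ ((Finset.univ : Finset (Fin m)).erase a), ∃ pp qq : Fin k,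
            (Φ cc pp).1 = xx ss ∧ (Φ cc qq).1 = xx (ss + 1)))).card : ℕ) : ℝ) ^ 2 ≤ ∑ w : Fin n, K₀ * N := by
    refine Finset.sum_le_sum fun w _ => le_trans (Finset.sum_le_sum fun Φ _ => ?_) (hS2 w)
    refine pow_le_pow_left₀ (Nat.cast_nonneg _) ?_ 2
    exact_mod_cast Finset.card_le_card (fun x hx => by
      rw [Finset.mem_filter] at hx ⊢
      exact ⟨hx.1, shwSeq_reach_mono Φ _ _ (Finset.erase_subset _ _) w x hx.2⟩)
  calc (1 / (n : ℝ)) * ∑ w : Fin n, ∑ Φ : (Fin m → Fin k → Fin n × Bool),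
        ((((Finset.univ : Finset (Fin n)).filter fun ww => (∃ (ll : ℕ) (xx : ℕ → Fin n), xx 0 = w ∧ xx ll = ww ∧ ∀ ss : ℕ, ss < ll →
          (xx ss < xx (ss + 1) ∧ ∃ cc ∈ ((Finset.univ : Finset (Fin m)).erase a), ∃ pp qq : Fin k,
            (Φ cc pp).1 = xx ss ∧ (Φ cc qq).1 = xx (ss + 1)))).card : ℕ) : ℝ) ^ 2
      ≤ (1 / (n : ℝ)) * ∑ _w : Fin n, K₀ * N := mul_le_mul_of_nonneg_left hmono (by positivity)
    _ = K₀ * N := by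
        rw [Finset.sum_const, Finset.card_univ, Fintype.card_fin, nsmul_eq_mul]
        field_simp

/-- **Post-processed sequential local rules are ℓ²-stable (polylogarithmic scale).** For `1 ≤ n`,
`m ≤ αn` and `e^{αke²} ≤ n³`: if `g₀` is an index-order decimation rule with unit look-ahead and `g`
is a radius-`r` local function of `(Φ, g₀ Φ)`, then
`∑_{(a,b)} ∑_{(Φ,ℓ)} d_H(g Φ, g Φ[(a,b) ↦ ℓ])² ≤ (8k²P + 2(k+1)²PK + 1)·(mk)·#Inst·2n`,
`P = (3k log n + k + 1)^{2r}`, `K = (1+αk²)e^{αk²(1+k²+αk²)}`. -/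
theorem shwSeqP_meanSquare (r : ℕ) (hn : 1 ≤ n) (α : ℝ) (hα : 0 ≤ α) (hm : (m : ℝ) ≤ α * n)
    (hlarge : Real.exp (α * k * Real.exp 2) ≤ (n : ℝ) ^ 3)
    (g₀ g : (Fin m → Fin k → Fin n × Bool) → (Fin n → Bool)) (hseq : (∀ (Φ Φ' : (Fin m → Fin k → Fin n × Bool)) (v : Fin n),
        (∀ i : Fin m, ((∃ j : Fin k, (Φ i j).1 = v) ∨ (∃ j : Fin k, (Φ' i j).1 = v)) → Φ i = Φ' i) →
        (∀ (i : Fin m) (j j' : Fin k), (Φ i j).1 = v → (Φ i j').1 < v →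
          g₀ Φ (Φ i j').1 = g₀ Φ' (Φ i j').1) →
        g₀ Φ v = g₀ Φ' v)) (hpost : (∀ (Φ Φ' : (Fin m → Fin k → Fin n × Bool)) (v : Fin n),
        (∀ i : Fin m, ((∃ j : Fin k, ∃ pw : ℕ → Fin n, pw 0 = v ∧ pw r = (Φ i j).1 ∧
          (∀ s, s < r → (pw s = pw (s + 1) ∨
            ∃ i' : Fin m, ∃ j₁ j₂ : Fin k, (Φ i' j₁).1 = pw s ∧ (Φ i' j₂).1 = pw (s + 1)))) ∨
         (∃ j : Fin k, ∃ pw : ℕ → Fin n, pw 0 = v ∧ pw r = (Φ' i j).1 ∧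
          (∀ s, s < r → (pw s = pw (s + 1) ∨
            ∃ i' : Fin m, ∃ j₁ j₂ : Fin k, (Φ' i' j₁).1 = pw s ∧ (Φ' i' j₂).1 = pw (s + 1))))) → Φ i = Φ' i) →
        (∀ u : Fin n, (∃ pw : ℕ → Fin n, pw 0 = v ∧ pw r = u ∧
          (∀ s, s < r → (pw s = pw (s + 1) ∨
            ∃ i' : Fin m, ∃ j₁ j₂ : Fin k, (Φ i' j₁).1 = pw s ∧ (Φ i' j₂).1 = pw (s + 1)))) → g₀ Φ u = g₀ Φ' u) →
        g Φ v = g Φ' v)) :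
    (∑ a : Fin m, ∑ b : Fin k, ∑ p : (Fin m → Fin k → Fin n × Bool) × (Fin n × Bool),
        (hammingDist (g p.1) (g (Function.update p.1 a (Function.update (p.1 a) b p.2))) : ℝ) ^ 2)
      ≤ (8 * (k : ℝ) ^ 2 * (3 * k * Real.log n + k + 1) ^ (2 * r) +
          2 * ((k : ℝ) + 1) ^ 2 * (3 * k * Real.log n + k + 1) ^ (2 * r) *
            ((1 + α * (k : ℝ) ^ 2) * Real.exp (α * (k : ℝ) ^ 2 * (1 + (k : ℝ) ^ 2 + α * (k : ℝ) ^ 2))) + 1)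
          * (((m * k : ℕ) : ℝ) * (Fintype.card (Fin m → Fin k → Fin n × Bool) * (2 * n))) := by
  have hnR : (1 : ℝ) ≤ n := by exact_mod_cast hn
  have hnpos : (0 : ℝ) < n := by linarith only [hnR]
  set N : ℝ := (Fintype.card (Fin m → Fin k → Fin n × Bool) : ℝ) with hN
  have hNnn : 0 ≤ N := by rw [hN]; exact Nat.cast_nonneg _
  set P : ℝ := (3 * k * Real.log n + k + 1) ^ (2 * r) with hP
  set β₀ : ℝ := (m : ℝ) * (k : ℝ) ^ 2 / n with hβ₀
  set β : ℝ := α * (k : ℝ) ^ 2 with hβ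
  have hβ₀β : β₀ ≤ β := by
    rw [hβ₀, hβ, div_le_iff₀ hnpos]
    have hk2 : (0 : ℝ) ≤ (k : ℝ) ^ 2 := by positivity
    nlinarith [mul_le_mul_of_nonneg_right hm hk2]
  have hβ₀0 : 0 ≤ β₀ := by rw [hβ₀]; positivity
  set K₀ : ℝ := (1 + β₀) * Real.exp (β₀ * (1 + (k : ℝ) ^ 2 + β₀)) with hK₀
  set K : ℝ := (1 + β) * Real.exp (β * (1 + (k : ℝ) ^ 2 + β)) with hK
  have hK₀0 : 0 ≤ K₀ := by rw [hK₀]; positivity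
  have hK₀K : K₀ ≤ K := by
    rw [hK₀, hK]
    have h1 : 1 + β₀ ≤ 1 + β := by linarith
    have h2 : Real.exp (β₀ * (1 + (k : ℝ) ^ 2 + β₀)) ≤ Real.exp (β * (1 + (k : ℝ) ^ 2 + β)) := by
      rw [Real.exp_le_exp]
      have : 0 ≤ 1 + (k : ℝ) ^ 2 + β₀ := by positivity
      nlinarith
    exact mul_le_mul h1 h2 (Real.exp_pos _).le (by linarith)
  have hlog0 : 0 ≤ Real.log n := Real.log_nonneg hnR
  have hP0 : 0 ≤ P := by rw [hP]; positivity
  -- the exceptional set and its size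
  set L' : ℕ := ⌊3 * Real.log n⌋₊ with hL'
  set BadS : Finset (Fin m → Fin k → Fin n × Bool) := (Finset.univ : Finset (Fin m → Fin k → Fin n × Bool)).filter
      fun Φ => L' < ((Finset.univ : Finset (Fin n)).sup fun v =>
          ((Finset.univ : Finset (Fin m)).filter fun i => ∃ j, (Φ i j).1 = v).card) with hBadS
  have hBadR : (n : ℝ) ^ 2 * (BadS.card : ℝ) ≤ N := by
    have htail := shwL_card_maxdeg_gt_le_real (m := m) (k := k) (n := n) L' hα hn hm
    rw [← hBadS] at htail
    have hL1 : 3 * Real.log n ≤ (L' : ℝ) + 1 := by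
      have := Nat.lt_floor_add_one (3 * Real.log n)
      rw [← hL'] at this
      exact this.le
    have hexpL : Real.exp (-(2 * ((L' : ℝ) + 1))) ≤ ((n : ℝ) ^ 6)⁻¹ := by
      rw [Real.exp_neg]
      apply inv_anti₀ (by positivity)
      calc (n : ℝ) ^ 6 = Real.exp (6 * Real.log n) := by
            rw [show (6 : ℝ) * Real.log n = ((6 : ℕ) : ℝ) * Real.log n by norm_num, Real.exp_nat_mul,
              Real.exp_log hnpos]
        _ ≤ Real.exp (2 * ((L' : ℝ) + 1)) := Real.exp_le_exp.2 (by linarith only [hL1])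
    have h1 : (BadS.card : ℝ) ≤ n * (Real.exp (α * k * Real.exp 2) * ((n : ℝ) ^ 6)⁻¹) * N := by
      calc (BadS.card : ℝ) ≤ n * (Real.exp (α * k * Real.exp 2) * Real.exp (-(2 * (L' + 1)))) * N := htail
        _ ≤ n * (Real.exp (α * k * Real.exp 2) * ((n : ℝ) ^ 6)⁻¹) * N := by gcongr
    have h2 : (n : ℝ) ^ 2 * (n * (Real.exp (α * k * Real.exp 2) * ((n : ℝ) ^ 6)⁻¹) * N)
        = Real.exp (α * k * Real.exp 2) * ((n : ℝ) ^ 3)⁻¹ * N := by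
      field_simp
    have h3 : Real.exp (α * k * Real.exp 2) * ((n : ℝ) ^ 3)⁻¹ ≤ 1 := by
      rw [← div_eq_mul_inv, div_le_one (by positivity)]
      exact hlarge
    calc (n : ℝ) ^ 2 * (BadS.card : ℝ)
        ≤ (n : ℝ) ^ 2 * (n * (Real.exp (α * k * Real.exp 2) * ((n : ℝ) ^ 6)⁻¹) * N) :=
          mul_le_mul_of_nonneg_left h1 (by positivity)
      _ = Real.exp (α * k * Real.exp 2) * ((n : ℝ) ^ 3)⁻¹ * N := h2
      _ ≤ 1 * N := mul_le_mul_of_nonneg_right h3 hNnn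
      _ = N := one_mul _
  -- pointwise bound, all instances
  have hpt : ∀ (a : Fin m) (b : Fin k) (Φ : (Fin m → Fin k → Fin n × Bool)) (ℓ : Fin n × Bool),
      ((hammingDist (g Φ) (g (Function.update Φ a (Function.update (Φ a) b ℓ))) : ℕ) : ℝ) ^ 2 ≤
        8 * (k : ℝ) ^ 2 * P + 2 * ((k : ℝ) + 1) * P * (∑ q : Fin k, ((((Finset.univ : Finset (Fin n)).filter fun ww => (∃ (ll : ℕ) (xx : ℕ → Fin n), xx 0 = ((Φ a q).1) ∧ xx ll = ww ∧ ∀ ss : ℕ, ss < ll →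
          (xx ss < xx (ss + 1) ∧ ∃ cc ∈ ((Finset.univ : Finset (Fin m)).erase a), ∃ pp qq : Fin k,
            (Φ cc pp).1 = xx ss ∧ (Φ cc qq).1 = xx (ss + 1)))).card : ℕ) : ℝ) ^ 2 + ((((Finset.univ : Finset (Fin n)).filter fun ww => (∃ (ll : ℕ) (xx : ℕ → Fin n), xx 0 = ℓ.1 ∧ xx ll = ww ∧ ∀ ss : ℕ, ss < ll →
          (xx ss < xx (ss + 1) ∧ ∃ cc ∈ (Finset.univ : Finset (Fin m)), ∃ pp qq : Fin k,
            (Φ cc pp).1 = xx ss ∧ (Φ cc qq).1 = xx (ss + 1)))).card : ℕ) : ℝ) ^ 2) +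
          (n : ℝ) ^ 2 * (if Φ ∈ BadS then 1 else 0) := by
    intro a b Φ ℓ
    have hsum0 : 0 ≤ ∑ q : Fin k, ((((Finset.univ : Finset (Fin n)).filter fun ww => (∃ (ll : ℕ) (xx : ℕ → Fin n), xx 0 = ((Φ a q).1) ∧ xx ll = ww ∧ ∀ ss : ℕ, ss < ll →
          (xx ss < xx (ss + 1) ∧ ∃ cc ∈ ((Finset.univ : Finset (Fin m)).erase a), ∃ pp qq : Fin k,
            (Φ cc pp).1 = xx ss ∧ (Φ cc qq).1 = xx (ss + 1)))).card : ℕ) : ℝ) ^ 2 + ((((Finset.univ : Finset (Fin n)).filter fun ww => (∃ (ll : ℕ) (xx : ℕ → Fin n), xx 0 = ℓ.1 ∧ xx ll = ww ∧ ∀ ss : ℕ, ss < ll →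
          (xx ss < xx (ss + 1) ∧ ∃ cc ∈ (Finset.univ : Finset (Fin m)), ∃ pp qq : Fin k,
            (Φ cc pp).1 = xx ss ∧ (Φ cc qq).1 = xx (ss + 1)))).card : ℕ) : ℝ) ^ 2 :=
      add_nonneg (Finset.sum_nonneg fun q _ => sq_nonneg _) (sq_nonneg _)
    by_cases hΦ : Φ ∈ BadS
    · rw [if_pos hΦ, mul_one]
      have hdn : ((hammingDist (g Φ) (g (Function.update Φ a (Function.update (Φ a) b ℓ))) : ℕ) : ℝ)
          ≤ n := by
        have := @hammingDist_le_card_fintype _ (fun _ => Bool) _ _ (g Φ)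
          (g (Function.update Φ a (Function.update (Φ a) b ℓ)))
        rw [Fintype.card_fin] at this
        exact_mod_cast this
      have hsq : ((hammingDist (g Φ) (g (Function.update Φ a (Function.update (Φ a) b ℓ))) : ℕ) : ℝ) ^ 2
          ≤ (n : ℝ) ^ 2 := pow_le_pow_left₀ (Nat.cast_nonneg _) hdn 2
      have hB0 : (0 : ℝ) ≤ 2 * ((k : ℝ) + 1) * P := by positivity
      have hA0 : (0 : ℝ) ≤ 8 * (k : ℝ) ^ 2 * P := by positivity
      have hBS := mul_nonneg hB0 hsum0
      linarith only [hsq, hA0, hBS]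
    · rw [if_neg hΦ, mul_zero, add_zero]
      have htyp : ((((Finset.univ : Finset (Fin n)).sup fun v =>
          ((Finset.univ : Finset (Fin m)).filter fun i => ∃ j, (Φ i j).1 = v).card) : ℕ) : ℝ) ≤ 3 * Real.log n := by
        rw [hBadS, Finset.mem_filter, not_and] at hΦ
        have hle : ((Finset.univ : Finset (Fin n)).sup fun v =>
          ((Finset.univ : Finset (Fin m)).filter fun i => ∃ j, (Φ i j).1 = v).card) ≤ L' := not_lt.1 (hΦ (Finset.mem_univ _))
        have hle' : ((((Finset.univ : Finset (Fin n)).sup fun v =>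
          ((Finset.univ : Finset (Fin m)).filter fun i => ∃ j, (Φ i j).1 = v).card) : ℕ) : ℝ) ≤ (L' : ℝ) := by exact_mod_cast hle
        exact hle'.trans (Nat.floor_le (by positivity))
      have h := shwSeqP_hamming_sq_le r g₀ g hseq hpost Φ (3 * Real.log n) htyp a b ℓ
      have hPk : ((k : ℝ) * (3 * Real.log n) + k + 1) ^ (2 * r) = P := by rw [hP]; ring
      rw [hPk] at h
      exact h
  -- sum over `(Φ, ℓ)` at a fixed position
  have hpos_ab : ∀ (a : Fin m) (b : Fin k),
      ∑ p : (Fin m → Fin k → Fin n × Bool) × (Fin n × Bool),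
        ((hammingDist (g p.1) (g (Function.update p.1 a (Function.update (p.1 a) b p.2))) : ℕ) : ℝ) ^ 2
        ≤ (8 * (k : ℝ) ^ 2 * P + 2 * ((k : ℝ) + 1) ^ 2 * P * K + 1) * (N * (2 * n)) := by
    intro a b
    rw [Fintype.sum_prod_type]
    have hcardC : (Fintype.card (Fin n × Bool) : ℝ) = 2 * n := by
      rw [Fintype.card_prod, Fintype.card_fin, Fintype.card_bool]; push_cast; ring
    -- the three pieces
    have hA : ∑ Φ : (Fin m → Fin k → Fin n × Bool), ∑ _ℓ : Fin n × Bool, (8 * (k : ℝ) ^ 2 * P) = 8 * (k : ℝ) ^ 2 * P * (N * (2 * n)) := by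
      simp only [Finset.sum_const, Finset.card_univ, nsmul_eq_mul, hcardC]
      rw [← hN]; ring
    have hB : ∑ Φ : (Fin m → Fin k → Fin n × Bool), ∑ ℓ : Fin n × Bool,
        2 * ((k : ℝ) + 1) * P * (∑ q : Fin k, ((((Finset.univ : Finset (Fin n)).filter fun ww => (∃ (ll : ℕ) (xx : ℕ → Fin n), xx 0 = ((Φ a q).1) ∧ xx ll = ww ∧ ∀ ss : ℕ, ss < ll →
          (xx ss < xx (ss + 1) ∧ ∃ cc ∈ ((Finset.univ : Finset (Fin m)).erase a), ∃ pp qq : Fin k,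
            (Φ cc pp).1 = xx ss ∧ (Φ cc qq).1 = xx (ss + 1)))).card : ℕ) : ℝ) ^ 2 + ((((Finset.univ : Finset (Fin n)).filter fun ww => (∃ (ll : ℕ) (xx : ℕ → Fin n), xx 0 = ℓ.1 ∧ xx ll = ww ∧ ∀ ss : ℕ, ss < ll →
          (xx ss < xx (ss + 1) ∧ ∃ cc ∈ (Finset.univ : Finset (Fin m)), ∃ pp qq : Fin k,
            (Φ cc pp).1 = xx ss ∧ (Φ cc qq).1 = xx (ss + 1)))).card : ℕ) : ℝ) ^ 2) ≤
          2 * ((k : ℝ) + 1) ^ 2 * P * K * (N * (2 * n)) := by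
      have hinner : ∀ Φ : (Fin m → Fin k → Fin n × Bool), ∑ ℓ : Fin n × Bool,
          2 * ((k : ℝ) + 1) * P * (∑ q : Fin k, ((((Finset.univ : Finset (Fin n)).filter fun ww => (∃ (ll : ℕ) (xx : ℕ → Fin n), xx 0 = ((Φ a q).1) ∧ xx ll = ww ∧ ∀ ss : ℕ, ss < ll →
          (xx ss < xx (ss + 1) ∧ ∃ cc ∈ ((Finset.univ : Finset (Fin m)).erase a), ∃ pp qq : Fin k,
            (Φ cc pp).1 = xx ss ∧ (Φ cc qq).1 = xx (ss + 1)))).card : ℕ) : ℝ) ^ 2 + ((((Finset.univ : Finset (Fin n)).filter fun ww => (∃ (ll : ℕ) (xx : ℕ → Fin n), xx 0 = ℓ.1 ∧ xx ll = ww ∧ ∀ ss : ℕ, ss < ll →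
          (xx ss < xx (ss + 1) ∧ ∃ cc ∈ (Finset.univ : Finset (Fin m)), ∃ pp qq : Fin k,
            (Φ cc pp).1 = xx ss ∧ (Φ cc qq).1 = xx (ss + 1)))).card : ℕ) : ℝ) ^ 2) =
          2 * ((k : ℝ) + 1) * P * ((2 * n) * ∑ q : Fin k, ((((Finset.univ : Finset (Fin n)).filter fun ww => (∃ (ll : ℕ) (xx : ℕ → Fin n), xx 0 = ((Φ a q).1) ∧ xx ll = ww ∧ ∀ ss : ℕ, ss < ll →
          (xx ss < xx (ss + 1) ∧ ∃ cc ∈ ((Finset.univ : Finset (Fin m)).erase a), ∃ pp qq : Fin k,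
            (Φ cc pp).1 = xx ss ∧ (Φ cc qq).1 = xx (ss + 1)))).card : ℕ) : ℝ) ^ 2 + ∑ ℓ : Fin n × Bool, ((((Finset.univ : Finset (Fin n)).filter fun ww => (∃ (ll : ℕ) (xx : ℕ → Fin n), xx 0 = ℓ.1 ∧ xx ll = ww ∧ ∀ ss : ℕ, ss < ll →
          (xx ss < xx (ss + 1) ∧ ∃ cc ∈ (Finset.univ : Finset (Fin m)), ∃ pp qq : Fin k,
            (Φ cc pp).1 = xx ss ∧ (Φ cc qq).1 = xx (ss + 1)))).card : ℕ) : ℝ) ^ 2) := by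
        intro Φ
        rw [← Finset.mul_sum, Finset.sum_add_distrib, Finset.sum_const, Finset.card_univ, nsmul_eq_mul,
          hcardC]
      rw [Finset.sum_congr rfl fun Φ _ => hinner Φ, ← Finset.mul_sum, Finset.sum_add_distrib,
        ← Finset.mul_sum]
      have hold : ∑ Φ : (Fin m → Fin k → Fin n × Bool), ∑ q : Fin k, ((((Finset.univ : Finset (Fin n)).filter fun ww => (∃ (ll : ℕ) (xx : ℕ → Fin n), xx 0 = ((Φ a q).1) ∧ xx ll = ww ∧ ∀ ss : ℕ, ss < ll →
          (xx ss < xx (ss + 1) ∧ ∃ cc ∈ ((Finset.univ : Finset (Fin m)).erase a), ∃ pp qq : Fin k,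
            (Φ cc pp).1 = xx ss ∧ (Φ cc qq).1 = xx (ss + 1)))).card : ℕ) : ℝ) ^ 2 ≤ k * (K₀ * N) := by
        rw [Finset.sum_comm]
        calc ∑ q : Fin k, ∑ Φ : (Fin m → Fin k → Fin n × Bool), ((((Finset.univ : Finset (Fin n)).filter fun ww => (∃ (ll : ℕ) (xx : ℕ → Fin n), xx 0 = ((Φ a q).1) ∧ xx ll = ww ∧ ∀ ss : ℕ, ss < ll →
          (xx ss < xx (ss + 1) ∧ ∃ cc ∈ ((Finset.univ : Finset (Fin m)).erase a), ∃ pp qq : Fin k,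
            (Φ cc pp).1 = xx ss ∧ (Φ cc qq).1 = xx (ss + 1)))).card : ℕ) : ℝ) ^ 2 ≤ ∑ _q : Fin k, K₀ * N :=
              Finset.sum_le_sum fun q _ => by
                have := shwSeqP_sum_cone_old (m := m) (k := k) hn a q
                rw [hK₀, hβ₀, hN]; exact this
          _ = k * (K₀ * N) := by rw [Finset.sum_const, Finset.card_univ, Fintype.card_fin, nsmul_eq_mul]
      have hlit : ∑ Φ : (Fin m → Fin k → Fin n × Bool), ∑ ℓ : Fin n × Bool, ((((Finset.univ : Finset (Fin n)).filter fun ww => (∃ (ll : ℕ) (xx : ℕ → Fin n), xx 0 = ℓ.1 ∧ xx ll = ww ∧ ∀ ss : ℕ, ss < ll →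
          (xx ss < xx (ss + 1) ∧ ∃ cc ∈ (Finset.univ : Finset (Fin m)), ∃ pp qq : Fin k,
            (Φ cc pp).1 = xx ss ∧ (Φ cc qq).1 = xx (ss + 1)))).card : ℕ) : ℝ) ^ 2 ≤ 2 * n * (K₀ * N) := by
        have := shwSeqP_sum_cone_lit (m := m) (k := k) hn
        rw [hK₀, hβ₀, hN]; exact this
      have hcoef0 : 0 ≤ 2 * ((k : ℝ) + 1) * P := by positivity
      calc 2 * ((k : ℝ) + 1) * P * ((2 * n) * ∑ Φ : (Fin m → Fin k → Fin n × Bool), ∑ q : Fin k, ((((Finset.univ : Finset (Fin n)).filter fun ww => (∃ (ll : ℕ) (xx : ℕ → Fin n), xx 0 = ((Φ a q).1) ∧ xx ll = ww ∧ ∀ ss : ℕ, ss < ll →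
          (xx ss < xx (ss + 1) ∧ ∃ cc ∈ ((Finset.univ : Finset (Fin m)).erase a), ∃ pp qq : Fin k,
            (Φ cc pp).1 = xx ss ∧ (Φ cc qq).1 = xx (ss + 1)))).card : ℕ) : ℝ) ^ 2 +
            ∑ Φ : (Fin m → Fin k → Fin n × Bool), ∑ ℓ : Fin n × Bool, ((((Finset.univ : Finset (Fin n)).filter fun ww => (∃ (ll : ℕ) (xx : ℕ → Fin n), xx 0 = ℓ.1 ∧ xx ll = ww ∧ ∀ ss : ℕ, ss < ll →
          (xx ss < xx (ss + 1) ∧ ∃ cc ∈ (Finset.univ : Finset (Fin m)), ∃ pp qq : Fin k,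
            (Φ cc pp).1 = xx ss ∧ (Φ cc qq).1 = xx (ss + 1)))).card : ℕ) : ℝ) ^ 2)
          ≤ 2 * ((k : ℝ) + 1) * P * ((2 * n) * (k * (K₀ * N)) + 2 * n * (K₀ * N)) := by
            apply mul_le_mul_of_nonneg_left _ hcoef0
            exact add_le_add (mul_le_mul_of_nonneg_left hold (by positivity)) hlit
        _ = 2 * ((k : ℝ) + 1) ^ 2 * P * K₀ * (N * (2 * n)) := by ring
        _ ≤ 2 * ((k : ℝ) + 1) ^ 2 * P * K * (N * (2 * n)) := by
            apply mul_le_mul_of_nonneg_right _ (by positivity)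
            exact mul_le_mul_of_nonneg_left hK₀K (by positivity)
    have hC : ∑ Φ : (Fin m → Fin k → Fin n × Bool), ∑ _ℓ : Fin n × Bool, (n : ℝ) ^ 2 * (if Φ ∈ BadS then (1 : ℝ) else 0) ≤
        N * (2 * n) := by
      have h1 : ∑ Φ : (Fin m → Fin k → Fin n × Bool), ∑ _ℓ : Fin n × Bool, (n : ℝ) ^ 2 * (if Φ ∈ BadS then (1 : ℝ) else 0) =
          (2 * n) * ((n : ℝ) ^ 2 * (BadS.card : ℝ)) := by
        simp only [Finset.sum_const, Finset.card_univ, hcardC, nsmul_eq_mul]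
        rw [← Finset.mul_sum, ← Finset.mul_sum, Finset.sum_boole]
        have : ((Finset.univ : Finset (Fin m → Fin k → Fin n × Bool)).filter fun Φ => Φ ∈ BadS) = BadS := by ext Φ; simp
        rw [this]
      rw [h1]
      nlinarith [hBadR, hnpos]
    calc ∑ Φ : (Fin m → Fin k → Fin n × Bool), ∑ ℓ : Fin n × Bool,
          ((hammingDist (g Φ) (g (Function.update Φ a (Function.update (Φ a) b ℓ))) : ℕ) : ℝ) ^ 2
        ≤ ∑ Φ : (Fin m → Fin k → Fin n × Bool), ∑ ℓ : Fin n × Bool, (8 * (k : ℝ) ^ 2 * P +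
            2 * ((k : ℝ) + 1) * P * (∑ q : Fin k, ((((Finset.univ : Finset (Fin n)).filter fun ww => (∃ (ll : ℕ) (xx : ℕ → Fin n), xx 0 = ((Φ a q).1) ∧ xx ll = ww ∧ ∀ ss : ℕ, ss < ll →
          (xx ss < xx (ss + 1) ∧ ∃ cc ∈ ((Finset.univ : Finset (Fin m)).erase a), ∃ pp qq : Fin k,
            (Φ cc pp).1 = xx ss ∧ (Φ cc qq).1 = xx (ss + 1)))).card : ℕ) : ℝ) ^ 2 + ((((Finset.univ : Finset (Fin n)).filter fun ww => (∃ (ll : ℕ) (xx : ℕ → Fin n), xx 0 = ℓ.1 ∧ xx ll = ww ∧ ∀ ss : ℕ, ss < ll →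
          (xx ss < xx (ss + 1) ∧ ∃ cc ∈ (Finset.univ : Finset (Fin m)), ∃ pp qq : Fin k,
            (Φ cc pp).1 = xx ss ∧ (Φ cc qq).1 = xx (ss + 1)))).card : ℕ) : ℝ) ^ 2) +
            (n : ℝ) ^ 2 * (if Φ ∈ BadS then 1 else 0)) :=
          Finset.sum_le_sum fun Φ _ => Finset.sum_le_sum fun ℓ _ => hpt a b Φ ℓ
      _ = ∑ Φ : (Fin m → Fin k → Fin n × Bool), ∑ _ℓ : Fin n × Bool, (8 * (k : ℝ) ^ 2 * P) +
          ∑ Φ : (Fin m → Fin k → Fin n × Bool), ∑ ℓ : Fin n × Bool,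
            2 * ((k : ℝ) + 1) * P * (∑ q : Fin k, ((((Finset.univ : Finset (Fin n)).filter fun ww => (∃ (ll : ℕ) (xx : ℕ → Fin n), xx 0 = ((Φ a q).1) ∧ xx ll = ww ∧ ∀ ss : ℕ, ss < ll →
          (xx ss < xx (ss + 1) ∧ ∃ cc ∈ ((Finset.univ : Finset (Fin m)).erase a), ∃ pp qq : Fin k,
            (Φ cc pp).1 = xx ss ∧ (Φ cc qq).1 = xx (ss + 1)))).card : ℕ) : ℝ) ^ 2 + ((((Finset.univ : Finset (Fin n)).filter fun ww => (∃ (ll : ℕ) (xx : ℕ → Fin n), xx 0 = ℓ.1 ∧ xx ll = ww ∧ ∀ ss : ℕ, ss < ll →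
          (xx ss < xx (ss + 1) ∧ ∃ cc ∈ (Finset.univ : Finset (Fin m)), ∃ pp qq : Fin k,
            (Φ cc pp).1 = xx ss ∧ (Φ cc qq).1 = xx (ss + 1)))).card : ℕ) : ℝ) ^ 2) +
          ∑ Φ : (Fin m → Fin k → Fin n × Bool), ∑ _ℓ : Fin n × Bool, (n : ℝ) ^ 2 * (if Φ ∈ BadS then (1 : ℝ) else 0) := by
          rw [← Finset.sum_add_distrib, ← Finset.sum_add_distrib]
          refine Finset.sum_congr rfl fun Φ _ => ?_
          rw [← Finset.sum_add_distrib, ← Finset.sum_add_distrib]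
      _ ≤ 8 * (k : ℝ) ^ 2 * P * (N * (2 * n)) + 2 * ((k : ℝ) + 1) ^ 2 * P * K * (N * (2 * n)) +
          N * (2 * n) := by rw [hA]; exact add_le_add (add_le_add le_rfl hB) hC
      _ = (8 * (k : ℝ) ^ 2 * P + 2 * ((k : ℝ) + 1) ^ 2 * P * K + 1) * (N * (2 * n)) := by ring
  -- sum over positions
  calc (∑ a : Fin m, ∑ b : Fin k, ∑ p : (Fin m → Fin k → Fin n × Bool) × (Fin n × Bool),
        ((hammingDist (g p.1) (g (Function.update p.1 a (Function.update (p.1 a) b p.2))) : ℕ) : ℝ) ^ 2)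
      ≤ ∑ _a : Fin m, ∑ _b : Fin k, (8 * (k : ℝ) ^ 2 * P + 2 * ((k : ℝ) + 1) ^ 2 * P * K + 1) * (N * (2 * n)) :=
        Finset.sum_le_sum fun a _ => Finset.sum_le_sum fun b _ => hpos_ab a b
    _ = (8 * (k : ℝ) ^ 2 * P + 2 * ((k : ℝ) + 1) ^ 2 * P * K + 1) * (((m * k : ℕ) : ℝ) * (N * (2 * n))) := by
        rw [Finset.sum_const, Finset.sum_const, Finset.card_univ, Finset.card_univ, Fintype.card_fin,
          Fintype.card_fin, smul_smul, nsmul_eq_mul]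
        push_cast; ring
    _ = _ := by rw [hP, hK, hβ]

end SeqPostMS

end Summit.PneNP.PneNP.Theorems
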